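import Mathlib
import HarnessLib
import Summits.NavierStokesRegularity.NavierStokesRegularity.Theorems.TransitMassLedgerLedgerRigidityEnergy
import Summits.NavierStokesRegularity.NavierStokesRegularity.Theorems.TransitMassLedgerLedgerRigidityLedger
import Summits.NavierStokesRegularity.NavierStokesRegularity.Theses.TransitMassLedger

/-!
# Route `TransitMassLedger`, support `CertifiedIncrementBound` (stmt-NavierStokesRegularity-27969) — proved

MULTI-STATE LEDGER ⇒ BUDGET: Step 1 of the `LedgerRigidity` proof (`TransitMassLedgerLedgerRigidityWindows.window_integral`)
widened from the degree-1 mass ledger `Σ⟪ℓ, V_n⟫` to an arbitrary two-state Lyapunov ledger `Σ_i Λ(V_{a+i}, V_{a+i+1})` with a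
three-state flux correction `g`.  Along a normalised, square-summable, action-bounded solution of the `λ = 1` model lattice:

* the production inequality summed over the window `i < w` reads `κ·D(s) + G_0(s) − G_w(s) ≤ F′(s)` pointwise, where
  `D = Σ_i ‖A V_{a+i} − A V_{a+i+1}‖²`, `F = Σ_i Λ(V_{a+i}, V_{a+i+1})` (derivative `F′` by the PACKAGED chain rule) and the
  `g`-terms telescope (`Finset.sum_range_sub'`) to the two boundary fluxes `G_0`, `G_w`;
* `g`, `Λ₁`, `Λ₂` are arbitrary functions (possibly non-measurable), so they are never integrated: the boundary fluxes are
  DOMINATED by the continuous `H(s) = C(‖V_{a-1}‖ + ‖V_a‖ + ‖V_{a+1}‖ + ‖V_{a+w-1}‖ + ‖V_{a+w}‖ + ‖V_{a+w+1}‖)(s)` and the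
  one-sided FTC `intervalIntegral.integral_le_sub_of_hasDeriv_right_of_le` is applied to `φ = κD − H ≤ F′`;
* `|F(s)| ≤ 2C Σ_{i ≤ w} ‖V_{a+i}(s)‖ ≤ 2C √((w+1)E)` by Cauchy–Schwarz with `E` the conserved energy
  (`TransitMassLedgerEnergy.energy_conserved`), and `∫ H ≤ 6CM` by the action bound (`abs_intervalIntegral_le`).

Hence `∫_{s₁}^{s₂} D ≤ C₁ √w + C₂` with `C₁ = 4C⁺√E/κ`, `C₂ = (4C⁺√E + 6C⁺M)/κ` (`C⁺ = max C 0`).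

HONEST FRAMING: elementary real analysis of Tao's MODEL lattice ODEs (λ = 1 limit); route `TransitMassLedger` is a booked
costume of the TL-M2Break reduction (see `TransitMassLedgerEmptyTransitClass`); this is its one non-vacuous support item.
Nothing here is about Navier–Stokes.
-/

noncomputable section

set_option linter.dupNamespace false

namespace Summit.NavierStokesRegularity.NavierStokesRegularity.Theorems.TransitMassLedgerCertifiedIncrementBound

open MeasureTheory Filter Topology Finset intervalIntegral Set
open scoped RealInnerProductSpace
open Literature.Analysis.FluidPDE Literature.Analysis.FluidPDE.TaoCascade
open Summit.NavierStokesRegularity.NavierStokesRegularity.Theorems.TransitMassLedgerEnergy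
open Summit.NavierStokesRegularity.NavierStokesRegularity.Theorems.TransitMassLedgerLedger

/-- A finite window of consecutive shells carries at most the total energy (as in
`TransitMassLedgerLedgerRigidityWindows.window_energy_le`). [folklore] -/
theorem window_energy_le' {m : ℕ} {V : ℤ → ℝ → Em m} (hs : ∀ s : ℝ, Summable fun n : ℤ => ‖V n s‖ ^ 2)
    (a : ℤ) (N : ℕ) (s : ℝ) : ∑ i ∈ range N, ‖V (a + i) s‖ ^ 2 ≤ ∑' j : ℤ, ‖V j s‖ ^ 2 := by
  have hinj : Set.InjOn (fun i : ℕ => a + (i : ℤ)) ((Finset.range N : Finset ℕ) : Set ℕ) :=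
    fun i _ j _ hij => by simpa using hij
  rw [← Finset.sum_image (f := fun j : ℤ => ‖V j s‖ ^ 2) hinj]
  exact sum_window_le_tsum hs _ s

/-- Cauchy–Schwarz for a window: `Σ_{i<n} ‖V_{a+i}(s)‖ ≤ √(n · E)` when the window energy is `≤ E`. [folklore] -/
theorem sum_norm_le_sqrt {m : ℕ} (V : ℤ → ℝ → Em m) (a : ℤ) (n : ℕ) (s : ℝ) {E : ℝ}
    (hE : ∑ i ∈ range n, ‖V (a + i) s‖ ^ 2 ≤ E) :
    ∑ i ∈ range n, ‖V (a + i) s‖ ≤ Real.sqrt (n * E) := by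
  have h0 : 0 ≤ ∑ i ∈ range n, ‖V (a + i) s‖ := Finset.sum_nonneg fun _ _ => norm_nonneg _
  refine Real.le_sqrt_of_sq_le ?_
  have hcs := Finset.sum_mul_sq_le_sq_mul_sq (range n) (fun i => ‖V (a + i) s‖) (fun _ => (1 : ℝ))
  simp only [mul_one, one_pow, Finset.sum_const, Finset.card_range, nsmul_eq_mul] at hcs
  calc (∑ i ∈ range n, ‖V (a + i) s‖) ^ 2 ≤ (∑ i ∈ range n, ‖V (a + i) s‖ ^ 2) * n := hcs
    _ ≤ E * n := mul_le_mul_of_nonneg_right hE (Nat.cast_nonneg n)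
    _ = n * E := mul_comm _ _

/-- `√(w + 1) ≤ √w + 1`. [folklore] -/
theorem sqrt_add_one_le (w : ℝ) (hw : 0 ≤ w) : Real.sqrt (w + 1) ≤ Real.sqrt w + 1 := by
  rw [Real.sqrt_le_left (by positivity)]
  nlinarith [Real.sq_sqrt hw, Real.sqrt_nonneg w]

/-- **`CertifiedIncrementBound` (stmt-NavierStokesRegularity-27969)** — the multi-state ledger budget.
[cite: Tao2016AveragedNS, §4 Lemma 4.1 (4.8) (local energy balance of the model lattice); folklore (telescoping,
Cauchy–Schwarz, one-sided FTC)] -/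
theorem transitMassLedger_certifiedIncrementBound_proof :
    Summit.NavierStokesRegularity.NavierStokesRegularity.Theses.TransitMassLedger.CertifiedIncrementBound := by
  intro R hR α hT hcert V hl hb hs hact
  obtain ⟨Λ, Λ₁, Λ₂, g, κ, C, hκ, hchain, hΛ, hg, hprod⟩ := hcert
  obtain ⟨M, hact⟩ := hact
  have hc : IsCancellingCoeff α := hT.2.1
  -- constants
  set Cp : ℝ := max C 0 with hCp
  have hCp0 : 0 ≤ Cp := le_max_right _ _
  have hCCp : C ≤ Cp := le_max_left _ _
  have hM0 : 0 ≤ M := le_trans (integral_nonneg fun s => norm_nonneg _) (hact 0).2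
  set E : ℝ := ∑' j : ℤ, ‖V j 0‖ ^ 2 with hE
  have hE0 : 0 ≤ E := tsum_nonneg fun _ => sq_nonneg _
  have hEs : ∀ s, ∑' j : ℤ, ‖V j s‖ ^ 2 = E := fun s => energy_conserved hc hl hb hs 0 s
  -- growth bounds with `Cp`
  have hΛ' : ∀ x y : Em 4, ‖x‖ ≤ 1 → ‖y‖ ≤ 1 → |Λ x y| ≤ Cp * (‖x‖ + ‖y‖) := fun x y hx hy =>
    (hΛ x y hx hy).trans (mul_le_mul_of_nonneg_right hCCp (by positivity))
  have hg' : ∀ x y z : Em 4, ‖x‖ ≤ 1 → ‖y‖ ≤ 1 → ‖z‖ ≤ 1 → |g x y z| ≤ Cp * (‖x‖ + ‖y‖ + ‖z‖) :=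
    fun x y z hx hy hz => (hg x y z hx hy hz).trans (mul_le_mul_of_nonneg_right hCCp (by positivity))
  refine ⟨4 * Cp * Real.sqrt E / κ, (4 * Cp * Real.sqrt E + 6 * Cp * M) / κ, ?_⟩
  intro a w s₁ s₂ h12
  have hV := continuous_shell hl
  have hA := continuous_tableA α
  -- the lattice derivative and the pointwise production inequality at a bond `(n, n+1)`
  set dV : ℤ → ℝ → Em 4 := fun n s =>
    tableQ α (V n s) + tableA α (V (n - 1) s) + tableB α (V (n + 1) s) (V n s) with hdV
  set Gf : ℤ → ℝ → ℝ := fun n s => g (V (n - 1) s) (V n s) (V (n + 1) s) with hGf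
  set Pf : ℤ → ℝ → ℝ := fun n s =>
    Λ₁ (V n s) (V (n + 1) s) (dV n s) + Λ₂ (V n s) (V (n + 1) s) (dV (n + 1) s) with hPf
  have hpt : ∀ (n : ℤ) (s : ℝ),
      κ * ‖tableA α (V n s) - tableA α (V (n + 1) s)‖ ^ 2 + Gf n s - Gf (n + 1) s ≤ Pf n s := by
    intro n s
    have h := hprod (V (n - 1) s) (V n s) (V (n + 1) s) (V (n + 1 + 1) s)
      (hb _ _) (hb _ _) (hb _ _) (hb _ _)
    simp only [hGf, hPf, hdV, add_sub_cancel_right]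
    linarith
  have hbond : ∀ (n : ℤ) (s : ℝ), HasDerivAt (fun σ => Λ (V n σ) (V (n + 1) σ)) (Pf n s) s :=
    fun n s => hchain (V n) (V (n + 1)) (dV n s) (dV (n + 1) s) s (hl n s) (hl (n + 1) s)
  -- the window sums
  set D : ℝ → ℝ := fun s => ∑ i ∈ range w, ‖tableA α (V (a + i) s) - tableA α (V (a + i + 1) s)‖ ^ 2
    with hD
  set F : ℝ → ℝ := fun s => ∑ i ∈ range w, Λ (V (a + i) s) (V (a + i + 1) s) with hF
  set F' : ℝ → ℝ := fun s => ∑ i ∈ range w, Pf (a + i) s with hF'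
  set H : ℝ → ℝ := fun s => Cp * (‖V (a - 1) s‖ + ‖V a s‖ + ‖V (a + 1) s‖)
    + Cp * (‖V (a + w - 1) s‖ + ‖V (a + w) s‖ + ‖V (a + w + 1) s‖) with hH
  have hFd : ∀ s, HasDerivAt F (F' s) s := by
    intro s
    simp only [hF, hF']
    exact HasDerivAt.fun_sum fun i _ => hbond (a + i) s
  -- telescoping of the flux corrections
  have htel : ∀ s, ∑ i ∈ range w, (Gf (a + i) s - Gf (a + i + 1) s) = Gf a s - Gf (a + w) s := by
    intro s
    have e : ∀ i : ℕ, Gf (a + i + 1) s = Gf (a + ((i + 1 : ℕ) : ℤ)) s := by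
      intro i; push_cast; rw [add_assoc]
    simp_rw [e]
    rw [Finset.sum_range_sub' (fun i : ℕ => Gf (a + (i : ℤ)) s) w]
    simp
  -- the pointwise window inequality `κ D + G_a − G_{a+w} ≤ F'`
  have hwin : ∀ s, κ * D s + Gf a s - Gf (a + w) s ≤ F' s := by
    intro s
    have h := Finset.sum_le_sum fun i (_ : i ∈ range w) => hpt (a + i) s
    have e : ∑ i ∈ range w, (κ * ‖tableA α (V (a + ↑i) s) - tableA α (V (a + ↑i + 1) s)‖ ^ 2
        + Gf (a + ↑i) s - Gf (a + ↑i + 1) s) = κ * D s + (Gf a s - Gf (a + w) s) := by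
      rw [← htel s]
      simp only [hD, Finset.mul_sum, ← Finset.sum_add_distrib]
      refine Finset.sum_congr rfl fun i _ => ?_
      ring
    have e2 : ∑ i ∈ range w, Pf (a + i) s = F' s := by simp only [hF']
    linarith [h, e, e2]
  -- domination of the boundary fluxes
  have hGle : ∀ (n : ℤ) (s : ℝ), |Gf n s| ≤ Cp * (‖V (n - 1) s‖ + ‖V n s‖ + ‖V (n + 1) s‖) :=
    fun n s => hg' _ _ _ (hb _ _) (hb _ _) (hb _ _)
  have hφ : ∀ s, κ * D s - H s ≤ F' s := by
    intro s
    have h1 := hGle a s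
    have h2 := hGle (a + w) s
    rw [abs_le] at h1 h2
    have h3 := hwin s
    simp only [hH]
    have e1 : a + ↑w - 1 = a + w - 1 := rfl
    linarith [h1.1, h1.2, h2.1, h2.2]
  -- continuity / integrability
  have hDc : Continuous D := by
    simp only [hD]
    exact continuous_finsetSum _ fun i _ => (((hA.comp (hV _)).sub (hA.comp (hV _))).norm.pow 2)
  have hHc : Continuous H := by
    simp only [hH]
    exact ((continuous_const.mul (((hV _).norm.add (hV _).norm).add (hV _).norm))).add
      (continuous_const.mul (((hV _).norm.add (hV _).norm).add (hV _).norm))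
  have hFc : Continuous F := continuous_iff_continuousAt.2 fun s => (hFd s).continuousAt
  -- one-sided FTC: `∫ (κ D − H) ≤ F s₂ − F s₁`
  have hFTC : ∫ s in s₁..s₂, (κ * D s - H s) ≤ F s₂ - F s₁ :=
    intervalIntegral.integral_le_sub_of_hasDeriv_right_of_le h12 hFc.continuousOn
      (fun s _ => (hFd s).hasDerivWithinAt) ((hDc.const_mul κ |>.sub hHc).integrableOn_Icc)
      (fun s _ => hφ s)
  -- `|F s| ≤ 2 Cp √((w+1) E)`
  have hFle : ∀ s, |F s| ≤ 2 * Cp * Real.sqrt ((w + 1 : ℕ) * E) := by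
    intro s
    have h1 : |F s| ≤ ∑ i ∈ range w, Cp * (‖V (a + i) s‖ + ‖V (a + i + 1) s‖) := by
      simp only [hF]
      refine (Finset.abs_sum_le_sum_abs _ _).trans (Finset.sum_le_sum fun i _ => ?_)
      exact hΛ' _ _ (hb _ _) (hb _ _)
    have h2 : ∑ i ∈ range w, Cp * (‖V (a + i) s‖ + ‖V (a + i + 1) s‖)
        ≤ 2 * Cp * ∑ i ∈ range (w + 1), ‖V (a + i) s‖ := by
      rw [← Finset.mul_sum, Finset.sum_add_distrib]
      have e1 : ∑ i ∈ range w, ‖V (a + ↑i + 1) s‖ ≤ ∑ i ∈ range (w + 1), ‖V (a + ↑i) s‖ := by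
        rw [Finset.sum_range_succ']
        have e2 : ∀ i : ℕ, ‖V (a + ↑i + 1) s‖ = ‖V (a + ↑(i + 1)) s‖ := by
          intro i; push_cast; rw [add_assoc]
        simp_rw [e2]
        linarith [norm_nonneg (V (a + ((0 : ℕ) : ℤ)) s)]
      have e3 : ∑ i ∈ range w, ‖V (a + ↑i) s‖ ≤ ∑ i ∈ range (w + 1), ‖V (a + ↑i) s‖ := by
        rw [Finset.sum_range_succ]
        linarith [norm_nonneg (V (a + ((w : ℕ) : ℤ)) s)]
      nlinarith
    have h3 : ∑ i ∈ range (w + 1), ‖V (a + i) s‖ ≤ Real.sqrt ((w + 1 : ℕ) * E) :=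
      sum_norm_le_sqrt V a (w + 1) s ((window_energy_le' hs a (w + 1) s).trans (hEs s).le)
    calc |F s| ≤ _ := h1
      _ ≤ _ := h2
      _ ≤ 2 * Cp * Real.sqrt ((w + 1 : ℕ) * E) := mul_le_mul_of_nonneg_left h3 (by positivity)
  -- `∫ H ≤ 6 Cp M`
  have hnorm_int : ∀ k : ℤ, |∫ s in s₁..s₂, ‖V k s‖| ≤ 1 * M := fun k =>
    abs_intervalIntegral_le (hV k).norm (hV k).norm (hact k).1 zero_le_one (hact k).2
      (fun s => norm_nonneg _) (fun s => by rw [one_mul, abs_of_nonneg (norm_nonneg _)]) h12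
  have hHint : ∫ s in s₁..s₂, H s ≤ 6 * Cp * M := by
    have i1 := fun k : ℤ => ((hV k).norm.intervalIntegrable (μ := volume) s₁ s₂)
    simp only [hH]
    rw [intervalIntegral.integral_add ((((i1 _).add (i1 _)).add (i1 _)).const_mul Cp)
      ((((i1 _).add (i1 _)).add (i1 _)).const_mul Cp),
      intervalIntegral.integral_const_mul, intervalIntegral.integral_const_mul,
      intervalIntegral.integral_add ((i1 _).add (i1 _)) (i1 _), intervalIntegral.integral_add (i1 _) (i1 _),
      intervalIntegral.integral_add ((i1 _).add (i1 _)) (i1 _), intervalIntegral.integral_add (i1 _) (i1 _)]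
    have b1 := hnorm_int (a - 1)
    have b2 := hnorm_int a
    have b3 := hnorm_int (a + 1)
    have b4 := hnorm_int (a + w - 1)
    have b5 := hnorm_int (a + w)
    have b6 := hnorm_int (a + w + 1)
    rw [abs_le, one_mul] at b1 b2 b3 b4 b5 b6
    have e1 : Cp * ((∫ s in s₁..s₂, ‖V (a - 1) s‖) + (∫ s in s₁..s₂, ‖V a s‖) + ∫ s in s₁..s₂, ‖V (a + 1) s‖)
        ≤ Cp * (3 * M) := mul_le_mul_of_nonneg_left (by linarith [b1.2, b2.2, b3.2]) hCp0
    have e2 : Cp * ((∫ s in s₁..s₂, ‖V (a + w - 1) s‖) + (∫ s in s₁..s₂, ‖V (a + w) s‖)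
        + ∫ s in s₁..s₂, ‖V (a + w + 1) s‖) ≤ Cp * (3 * M) :=
      mul_le_mul_of_nonneg_left (by linarith [b4.2, b5.2, b6.2]) hCp0
    linarith
  -- split `∫ (κ D − H) = κ ∫ D − ∫ H`
  have hsplit : ∫ s in s₁..s₂, (κ * D s - H s) = κ * (∫ s in s₁..s₂, D s) - ∫ s in s₁..s₂, H s := by
    rw [intervalIntegral.integral_sub ((hDc.intervalIntegrable _ _).const_mul κ) (hHc.intervalIntegrable _ _),
      intervalIntegral.integral_const_mul]
  -- assemble
  have hF1 := hFle s₁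
  have hF2 := hFle s₂
  rw [abs_le] at hF1 hF2
  have hsq : Real.sqrt ((w + 1 : ℕ) * E) ≤ Real.sqrt E * Real.sqrt w + Real.sqrt E := by
    rw [Real.sqrt_mul' _ hE0, mul_comm]
    have h1 : Real.sqrt ((w + 1 : ℕ) : ℝ) ≤ Real.sqrt w + 1 := by
      push_cast; exact sqrt_add_one_le w (Nat.cast_nonneg w)
    nlinarith [Real.sqrt_nonneg E, Real.sqrt_nonneg (w : ℝ)]
  have hmain : κ * (∫ s in s₁..s₂, D s) ≤ 4 * Cp * Real.sqrt E * Real.sqrt w + (4 * Cp * Real.sqrt E + 6 * Cp * M) := by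
    have h1 : κ * (∫ s in s₁..s₂, D s) ≤ (F s₂ - F s₁) + ∫ s in s₁..s₂, H s := by
      rw [hsplit] at hFTC; linarith
    have h2 : F s₂ - F s₁ ≤ 4 * Cp * Real.sqrt ((w + 1 : ℕ) * E) := by linarith [hF1.1, hF2.2]
    have h3 : 4 * Cp * Real.sqrt ((w + 1 : ℕ) * E) ≤ 4 * Cp * (Real.sqrt E * Real.sqrt w + Real.sqrt E) :=
      mul_le_mul_of_nonneg_left hsq (by positivity)
    linarith
  -- divide by `κ`
  have hgoal : (∫ s in s₁..s₂, D s) ≤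
      4 * Cp * Real.sqrt E / κ * Real.sqrt w + (4 * Cp * Real.sqrt E + 6 * Cp * M) / κ := by
    rw [div_mul_eq_mul_div, ← add_div, le_div_iff₀ hκ]
    linarith
  simpa only [hD] using hgoal

end Summit.NavierStokesRegularity.NavierStokesRegularity.Theorems.TransitMassLedgerCertifiedIncrementBound

end
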